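import Summits.HubbardSuperconductivity.HubbardSuperconductivity.Theorems.WidthHaldaneTubeTwoCut
import Summits.HubbardSuperconductivity.HubbardSuperconductivity.Theorems.WidthHaldaneTubeBlochBound

/-!
# Semiconcavity of the flux envelope of the Hubbard tube; the a-priori window `-10 ≤ ρ̃ ≤ 2`

Support file for the tube cruxes over `WidthHaldaneDefs` (items stmt-HubbardSuperconductivity-16310/
16311/16312/18509/18510), all PROVED, no definitions. (1) BASE-FLUX GAUGE (`L ≥ 3`): spreading only the
part `φ` of the seam flux `θ₀ + φ` by `g_z = e^{iφ z₁/L}` leaves the hopping coefficients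
`-ω_φ(x,y) β_{θ₀}(x,y)` (uniform Peierls weight × base seam phase `e^{± iθ₀}` on the seam bonds):
`gauge_pointwise_base`, `expect_gauged_tubeH_base`, `expect_tubeH_base`. (2) SEMICONCAVITY
`tubeEnergy_semiconcave`: `E(θ₀+φ) + E(θ₀-φ) ≤ 2E(θ₀) + 2φ²M/L` for every base flux (the `±` trick of
Bohm/Watanabe at `θ₀`; at `θ₀ = 0` it is Bloch's bound). (3) COROLLARIES: `abs_tubeEnergy_pi_sub_zero_le`
(`|E(π) - E(0)| ≤ π²M/L`: the period-halving bound of the `two-cut-transparency` line is free for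
`η ≥ π²`), `tubeEnergy_pi_add_eq_pi_sub`, `tubeEnergy_pi_add_le` (Bloch from the `π`-flux),
`neg_le_tubeEnergy_pi_div_three_sub_zero` (`E(π/3) - E(0) ≥ -(5π²/9)M/L`) and
`neg_ten_le_tubeStiffness`: **`-10 ≤ ρ̃_{L,M}(U,δ)`**, so with `tubeStiffness_le_two` the twist
stiffness per site lives a priori in `[-10, 2]` — the floors of 16312/18510 are statements inside
this kinematic window. References: D. Bohm, Phys. Rev. 75 (1949) 502; H. Watanabe, J. Stat. Phys.
177 (2019) 717, §2.2, §4.1; N. Byers, C. N. Yang, PRL 7 (1961) 46.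
-/

noncomputable section

namespace Summit.HubbardSuperconductivity.HubbardSuperconductivity.Theorems.WidthHaldane

set_option linter.dupNamespace false -- summit = problem name (single-conjunct summit), D-0017

open scoped BigOperators Classical Matrix ComplexConjugate
open Matrix Literature.MathematicalPhysics.QuantumLattice
open Summit.HubbardSuperconductivity.HubbardSuperconductivity.Theorems.DeformationLadder
  (phaseGauge_conj_hamiltonian expect_phaseGauge_conj_hamiltonian expect_hamiltonian_eq)

section BaseGauge

variable (L M : ℕ) [NeZero L] [NeZero M] (Λ : Type) [LinearOrder Λ] [Fintype Λ]
  (e : Λ ≃ ZMod L × ZMod M)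

omit [NeZero M] [LinearOrder Λ] [Fintype Λ] in
/-- The spreading gauge across the seam: on a seam pair `x = (0,b)`, `y = (-1,b)`,
`g_x conj g_y = e^{iφ/L} e^{-iφ}` (`g_z = e^{iφ z₁/L}`). [folklore] -/
theorem twistGauge_seam (φ : ℝ) {x y : Λ} (h : (e x).1 = 0 ∧ y = e.symm (-1, (e x).2)) :
    ((Circle.exp (φ / L * ((e x).1.val : ℝ)) : ℂ) * conj (Circle.exp (φ / L * ((e y).1.val : ℝ)) : ℂ)) =
      Complex.exp (((φ / L : ℝ) : ℂ) * Complex.I) * Complex.exp (-(Complex.I * φ)) := by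
  have hL0 : (L : ℂ) ≠ 0 := by exact_mod_cast (NeZero.ne L)
  have hy : (e y).1 = -1 := by rw [h.2, Equiv.apply_symm_apply]
  rw [twistGauge_mul_conj, h.1, ZMod.val_zero, val_cast_of_eq_neg_one L hy, Nat.cast_zero, mul_zero,
    ← Complex.exp_add]
  congr 1
  push_cast
  field_simp
  ring

omit [NeZero M] [LinearOrder Λ] [Fintype Λ] in
/-- The spreading gauge across the seam, reversed orientation: `g_x conj g_y = e^{-iφ/L} e^{iφ}`. [folklore] -/
theorem twistGauge_seam' (φ : ℝ) {x y : Λ} (h : (e y).1 = 0 ∧ x = e.symm (-1, (e y).2)) :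
    ((Circle.exp (φ / L * ((e x).1.val : ℝ)) : ℂ) * conj (Circle.exp (φ / L * ((e y).1.val : ℝ)) : ℂ)) =
      Complex.exp (-(((φ / L : ℝ) : ℂ) * Complex.I)) * Complex.exp (Complex.I * φ) := by
  have hL0 : (L : ℂ) ≠ 0 := by exact_mod_cast (NeZero.ne L)
  have hx : (e x).1 = -1 := by rw [h.2, Equiv.apply_symm_apply]
  rw [twistGauge_mul_conj, h.1, ZMod.val_zero, val_cast_of_eq_neg_one L hx, Nat.cast_zero, mul_zero,
    ← Complex.exp_add]
  congr 1
  push_cast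
  field_simp
  ring

omit [NeZero L] [NeZero M] [LinearOrder Λ] [Fintype Λ] in
/-- A seam pair is a longitudinal step `x = y + e₁` in the same column. [folklore] -/
theorem seam_pair_step {x y : Λ} (h : (e x).1 = 0 ∧ y = e.symm (-1, (e x).2)) :
    (e x).1 = (e y).1 + 1 ∧ (e x).2 = (e y).2 := by
  have hey : e y = (-1, (e x).2) := by rw [h.2, Equiv.apply_symm_apply]
  rw [hey, h.1]
  exact ⟨by ring, rfl⟩

omit [NeZero L] [NeZero M] [LinearOrder Λ] [Fintype Λ] in
/-- A reversed seam pair is NOT a step `x = y + e₁` (`L ≥ 3`: `-1 ≠ 0 + 1`). [folklore] -/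
theorem seam_pair_not_step' (hL : 3 ≤ L) {x y : Λ} (h : (e y).1 = 0 ∧ x = e.symm (-1, (e y).2)) :
    ¬ ((e x).1 = (e y).1 + 1 ∧ (e x).2 = (e y).2) := by
  have hex : e x = (-1, (e y).2) := by rw [h.2, Equiv.apply_symm_apply]
  rintro ⟨h1, -⟩
  rw [hex, h.1, zero_add] at h1
  exact two_ne_zero_zmod L hL (by linear_combination -h1)

omit [NeZero M] [Fintype Λ] in
/-- **The pointwise gauge identity at a base flux** (`L ≥ 3`): spreading `φ` out of the seam flux
`θ₀ + φ` leaves the coefficient `-ω_φ(x,y)·β_{θ₀}(x,y)`. [cite: Watanabe2019, §2.2.3 and §4.1] -/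
theorem gauge_pointwise_base (hL : 3 ≤ L) (θ₀ φ : ℝ) (x y : Λ) :
    -(if (tubeGraph e).Adj x y then
        (Circle.exp (φ / L * ((e x).1.val : ℝ)) : ℂ) * conj (Circle.exp (φ / L * ((e y).1.val : ℝ)) : ℂ)
        else 0) +
      (if (e x).1 = 0 ∧ y = e.symm (-1, (e x).2) then (1 - Complex.exp (Complex.I * ↑(θ₀ + φ))) *
        ((Circle.exp (φ / L * ((e x).1.val : ℝ)) : ℂ) * conj (Circle.exp (φ / L * ((e y).1.val : ℝ)) : ℂ))
        else 0) +
      (if (e y).1 = 0 ∧ x = e.symm (-1, (e y).2) then (1 - Complex.exp (-(Complex.I * ↑(θ₀ + φ)))) *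
        ((Circle.exp (φ / L * ((e x).1.val : ℝ)) : ℂ) * conj (Circle.exp (φ / L * ((e y).1.val : ℝ)) : ℂ))
        else 0) =
    -(if (tubeGraph e).Adj x y then
        (if (e x).1 = (e y).1 + 1 ∧ (e x).2 = (e y).2 then Complex.exp (((φ / L : ℝ) : ℂ) * Complex.I)
          else if (e y).1 = (e x).1 + 1 ∧ (e x).2 = (e y).2 then Complex.exp (-(((φ / L : ℝ) : ℂ) * Complex.I))
          else 1) *
        (if (e x).1 = 0 ∧ y = e.symm (-1, (e x).2) then Complex.exp (Complex.I * θ₀)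
          else if (e y).1 = 0 ∧ x = e.symm (-1, (e y).2) then Complex.exp (-(Complex.I * θ₀)) else 1)
        else 0) := by
  have key := gauge_pointwise L M Λ e hL φ x y
  have k1 : ¬ ((1 : ZMod L) = 0) := by
    haveI : Fact (1 < L) := ⟨by omega⟩
    exact one_ne_zero
  by_cases hsp : (e x).1 = 0 ∧ y = e.symm (-1, (e x).2)
  · obtain ⟨hadj, hsm, -, -⟩ := seam_pair_facts L M Λ e hL (k := 1) k1 hsp
    have hc1 := seam_pair_step L M Λ e hsp
    rw [twistGauge_seam L M Λ e φ hsp]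
    simp only [if_pos hadj, if_pos hsp, if_neg hsm, if_pos hc1]
    have hz : Complex.exp (Complex.I * ↑(θ₀ + φ)) * Complex.exp (-(Complex.I * φ)) =
        Complex.exp (Complex.I * θ₀) := by
      rw [← Complex.exp_add]; congr 1; push_cast; ring
    linear_combination (-Complex.exp (((φ / L : ℝ) : ℂ) * Complex.I)) * hz
  · by_cases hsm : (e y).1 = 0 ∧ x = e.symm (-1, (e y).2)
    · obtain ⟨hadj, -, -, -⟩ := seam_pair_facts' L M Λ e hL (k := 1) k1 hsm
      have hc1 := seam_pair_not_step' L M Λ e hL hsm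
      have hc2 : (e y).1 = (e x).1 + 1 ∧ (e x).2 = (e y).2 := by
        have h := seam_pair_step L M Λ e (x := y) (y := x) hsm
        exact ⟨h.1, h.2.symm⟩
      rw [twistGauge_seam' L M Λ e φ hsm]
      simp only [if_pos hadj, if_neg hsp, if_pos hsm, if_neg hc1, if_pos hc2]
      have hz : Complex.exp (-(Complex.I * ↑(θ₀ + φ))) * Complex.exp (Complex.I * φ) =
          Complex.exp (-(Complex.I * θ₀)) := by
        rw [← Complex.exp_add]; congr 1; push_cast; ring
      linear_combination (-Complex.exp (-(((φ / L : ℝ) : ℂ) * Complex.I))) * hz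
    · simp only [if_neg hsp, if_neg hsm, mul_one] at key ⊢
      exact key

/-- **The gauged tube at a base flux, in expectation** (`L ≥ 3`):
`⟨ψ, W_φ (H₀ + Tw_{θ₀+φ}) W_φᴴ ψ⟩ = -Σ_{x∼y,σ} ω_φ β_{θ₀} ⟨ψ, c†_{xσ}c_{yσ} ψ⟩ + U⟨ψ, Σ n↑n↓ ψ⟩`. [cite: Watanabe2019, §2.2.3 and §4.1] -/
theorem expect_gauged_tubeH_base (hL : 3 ≤ L) (U θ₀ φ : ℝ) (ψ : Fock (Orb Λ)) :
    expect (phaseGauge (fun z : Λ => Circle.exp (φ / L * ((e z).1.val : ℝ))) *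
        (tubeH0 L M Λ e U + tubeTwist L M Λ e (θ₀ + φ)) *
        (phaseGauge (fun z : Λ => Circle.exp (φ / L * ((e z).1.val : ℝ))))ᴴ) ψ =
      -(∑ x : Λ, ∑ y : Λ, ∑ σ : Fin 2, if (tubeGraph e).Adj x y then
          (if (e x).1 = (e y).1 + 1 ∧ (e x).2 = (e y).2 then Complex.exp (((φ / L : ℝ) : ℂ) * Complex.I)
            else if (e y).1 = (e x).1 + 1 ∧ (e x).2 = (e y).2 then Complex.exp (-(((φ / L : ℝ) : ℂ) * Complex.I))
            else 1) *
          (if (e x).1 = 0 ∧ y = e.symm (-1, (e x).2) then Complex.exp (Complex.I * θ₀)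
            else if (e y).1 = 0 ∧ x = e.symm (-1, (e y).2) then Complex.exp (-(Complex.I * θ₀)) else 1) *
          expect (creation (orb x σ) * annihilation (orb y σ)) ψ
          else 0) +
        (U : ℂ) * expect (∑ x : Λ, numberOp x 0 * numberOp x 1) ψ := by
  rw [Matrix.mul_add, Matrix.add_mul, expect_add, tubeH0_eq, expect_phaseGauge_conj_hamiltonian,
    expect_phaseGauge_conj_tubeTwist]
  simp only [Finset.sum_add_distrib]
  rw [sum_seam_eq_sum_sum L M Λ e (fun x y => ∑ σ : Fin 2, (1 - Complex.exp (Complex.I * ↑(θ₀ + φ))) *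
      (((Circle.exp (φ / L * ((e x).1.val : ℝ)) : ℂ) * conj (Circle.exp (φ / L * ((e y).1.val : ℝ)) : ℂ)) *
        expect (creation (orb x σ) * annihilation (orb y σ)) ψ)),
    sum_seam_eq_sum_sum' L M Λ e (fun x y => ∑ σ : Fin 2, (1 - Complex.exp (-(Complex.I * ↑(θ₀ + φ)))) *
      (((Circle.exp (φ / L * ((e x).1.val : ℝ)) : ℂ) * conj (Circle.exp (φ / L * ((e y).1.val : ℝ)) : ℂ)) *
        expect (creation (orb x σ) * annihilation (orb y σ)) ψ))]
  simp only [ite_sum_fin_two]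
  rw [Complex.ofReal_one, neg_one_mul, add_assoc, add_comm ((U : ℂ) * _), ← add_assoc, ← add_assoc,
    add_left_inj]
  simp only [← Finset.sum_neg_distrib, ← Finset.sum_add_distrib]
  refine Finset.sum_congr rfl fun x _ => Finset.sum_congr rfl fun y _ => Finset.sum_congr rfl fun σ _ => ?_
  have key := gauge_pointwise_base L M Λ e hL θ₀ φ x y
  split_ifs at key ⊢ <;>
    linear_combination (expect (creation (orb x σ) * annihilation (orb y σ)) ψ) * key

/-- **The seam-twisted tube in expectation**: `⟨ψ, (H₀ + Tw_{θ₀}) ψ⟩ = -Σ_{x∼y,σ} β_{θ₀}(x,y) h + U⟨nn⟩`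
(the case `φ = 0` of `expect_gauged_tubeH_base`: nothing to spread). [folklore] -/
theorem expect_tubeH_base (hL : 3 ≤ L) (U θ₀ : ℝ) (ψ : Fock (Orb Λ)) :
    expect (tubeH0 L M Λ e U + tubeTwist L M Λ e θ₀) ψ =
      -(∑ x : Λ, ∑ y : Λ, ∑ σ : Fin 2, if (tubeGraph e).Adj x y then
          (if (e x).1 = 0 ∧ y = e.symm (-1, (e x).2) then Complex.exp (Complex.I * θ₀)
            else if (e y).1 = 0 ∧ x = e.symm (-1, (e y).2) then Complex.exp (-(Complex.I * θ₀)) else 1) *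
          expect (creation (orb x σ) * annihilation (orb y σ)) ψ
          else 0) +
        (U : ℂ) * expect (∑ x : Λ, numberOp x 0 * numberOp x 1) ψ := by
  have h := expect_gauged_tubeH_base L M Λ e hL U θ₀ 0 ψ
  have hg : (fun z : Λ => Circle.exp (0 / L * ((e z).1.val : ℝ))) = 1 := by
    funext z
    simp
  rw [hg, phaseGauge_one, Matrix.one_mul, conjTranspose_one, Matrix.mul_one, add_zero] at h
  rw [h]
  congr 1
  simp only [zero_div, Complex.ofReal_zero, zero_mul, neg_zero, Complex.exp_zero, ite_self, one_mul]

end BaseGauge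

section Semiconcave

variable (L M : ℕ) [NeZero L] [NeZero M] (Λ : Type) [LinearOrder Λ] [Fintype Λ]
  (e : Λ ≃ ZMod L × ZMod M)

/-- Real part of the price of spreading `φ`: `Re⟨W_φ H_{θ₀+φ} W_φᴴ⟩ = Re⟨H_{θ₀}⟩ + Σ Re[(1-ω_φ)(β_{θ₀}h)]`.
[cite: Watanabe2019, §2.2.3 and §4.1] -/
theorem re_expect_gauged_base (hL : 3 ≤ L) (U θ₀ φ : ℝ) (ψ : Fock (Orb Λ)) :
    (expect (phaseGauge (fun z : Λ => Circle.exp (φ / L * ((e z).1.val : ℝ))) *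
        (tubeH0 L M Λ e U + tubeTwist L M Λ e (θ₀ + φ)) *
        (phaseGauge (fun z : Λ => Circle.exp (φ / L * ((e z).1.val : ℝ))))ᴴ) ψ).re =
      (expect (tubeH0 L M Λ e U + tubeTwist L M Λ e θ₀) ψ).re +
        ∑ x : Λ, ∑ y : Λ, ∑ σ : Fin 2, if (tubeGraph e).Adj x y then
          ((1 - (if (e x).1 = (e y).1 + 1 ∧ (e x).2 = (e y).2 then Complex.exp (((φ / L : ℝ) : ℂ) * Complex.I)
            else if (e y).1 = (e x).1 + 1 ∧ (e x).2 = (e y).2 then Complex.exp (-(((φ / L : ℝ) : ℂ) * Complex.I))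
            else 1)) *
            ((if (e x).1 = 0 ∧ y = e.symm (-1, (e x).2) then Complex.exp (Complex.I * θ₀)
              else if (e y).1 = 0 ∧ x = e.symm (-1, (e y).2) then Complex.exp (-(Complex.I * θ₀)) else 1) *
              expect (creation (orb x σ) * annihilation (orb y σ)) ψ)).re
          else 0 := by
  rw [expect_gauged_tubeH_base L M Λ e hL U θ₀ φ ψ, expect_tubeH_base L M Λ e hL U θ₀ ψ,
    Complex.add_re, Complex.add_re, Complex.neg_re, Complex.neg_re, Complex.re_sum, Complex.re_sum]
  rw [show ∀ (A B C : ℝ), -A + C = -B + C + (B - A) from fun A B C => by ring, add_right_inj,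
    ← Finset.sum_sub_distrib]
  refine Finset.sum_congr rfl fun x _ => ?_
  rw [Complex.re_sum, Complex.re_sum, ← Finset.sum_sub_distrib]
  refine Finset.sum_congr rfl fun y _ => ?_
  rw [Complex.re_sum, Complex.re_sum, ← Finset.sum_sub_distrib]
  refine Finset.sum_congr rfl fun σ _ => ?_
  by_cases hadj : (tubeGraph e).Adj x y
  · rw [if_pos hadj, if_pos hadj, if_pos hadj, ← Complex.sub_re]
    congr 1
    ring
  · rw [if_neg hadj, if_neg hadj, if_neg hadj, sub_self]

omit [NeZero L] [NeZero M] [Fintype Λ] in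
/-- The base seam phase has modulus `≤ 1`. [folklore] -/
theorem norm_basePhase_le (θ₀ : ℝ) (x y : Λ) :
    ‖(if (e x).1 = 0 ∧ y = e.symm (-1, (e x).2) then Complex.exp (Complex.I * θ₀)
      else if (e y).1 = 0 ∧ x = e.symm (-1, (e y).2) then Complex.exp (-(Complex.I * θ₀)) else 1)‖ ≤ 1 := by
  split_ifs
  · rw [Complex.norm_exp_I_mul_ofReal]
  · rw [show -(Complex.I * (θ₀ : ℂ)) = Complex.I * ((-θ₀ : ℝ) : ℂ) by push_cast; ring,
      Complex.norm_exp_I_mul_ofReal]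
  · rw [norm_one]

/-- **Semiconcavity of the flux envelope** (`L ≥ 3`): for every base flux `θ₀` and increment `φ`,
`E(θ₀ + φ) + E(θ₀ - φ) ≤ 2E(θ₀) + 2φ²M/L` (price `W_{±φ}ᴴψ` for a near-minimiser `ψ` of `H₀ + Tw_{θ₀}`;
the currents cancel; `2LM` longitudinal hops at `≤ (2 - 2cos(φ/L))/2` each). [cite: Watanabe2019, §2.2.3 and §4.1] -/
theorem tubeEnergy_semiconcave (hL : 3 ≤ L) (U θ₀ φ : ℝ) (N : ℕ) :
    tubeEnergy L M Λ e U (θ₀ + φ) N + tubeEnergy L M Λ e U (θ₀ - φ) N ≤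
      2 * tubeEnergy L M Λ e U θ₀ N + 2 * (φ ^ 2 * M / L) := by
  have hc : 0 ≤ 2 * (φ ^ 2 * M / L) := by positivity
  have hunit : ∀ ψ ∈ szSector (Λ := Λ) N 0, star ψ ⬝ᵥ ψ = 1 →
      tubeEnergy L M Λ e U (θ₀ + φ) N + tubeEnergy L M Λ e U (θ₀ - φ) N ≤
        2 * (expect (tubeH0 L M Λ e U + tubeTwist L M Λ e θ₀) ψ).re + 2 * (φ ^ 2 * M / L) := by
    intro ψ hψ h1
    have hgauge : ∀ φ' : ℝ, tubeEnergy L M Λ e U (θ₀ + φ') N ≤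
        (expect (phaseGauge (fun z : Λ => Circle.exp (φ' / L * ((e z).1.val : ℝ))) *
          (tubeH0 L M Λ e U + tubeTwist L M Λ e (θ₀ + φ')) *
          (phaseGauge (fun z : Λ => Circle.exp (φ' / L * ((e z).1.val : ℝ))))ᴴ) ψ).re := by
      intro φ'
      set g : Λ → Circle := fun z : Λ => Circle.exp (φ' / L * ((e z).1.val : ℝ)) with hg
      have hu := minEnergyOn_szSector_phaseGauge_conj g⁻¹ (tubeH0 L M Λ e U + tubeTwist L M Λ e (θ₀ + φ')) N 0
      rw [phaseGauge_conjTranspose, inv_inv, ← phaseGauge_conjTranspose g] at hu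
      rw [tubeEnergy_eq, ← hu]
      exact minEnergyOn_le_rayleigh_of_mem
        (Matrix.isHermitian_mul_mul_conjTranspose _ (isHermitian_tubeH L M Λ e U (θ₀ + φ'))) _ hψ h1
    have hp := hgauge φ
    have hm := hgauge (-φ)
    rw [← sub_eq_add_neg] at hm
    rw [re_expect_gauged_base L M Λ e hL] at hp
    rw [show θ₀ - φ = θ₀ + -φ by ring, re_expect_gauged_base L M Λ e hL, ← show θ₀ - φ = θ₀ + -φ by ring] at hm
    have hsum : (∑ x : Λ, ∑ y : Λ, ∑ σ : Fin 2, if (tubeGraph e).Adj x y then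
        ((1 - (if (e x).1 = (e y).1 + 1 ∧ (e x).2 = (e y).2 then Complex.exp (((φ / L : ℝ) : ℂ) * Complex.I)
          else if (e y).1 = (e x).1 + 1 ∧ (e x).2 = (e y).2 then Complex.exp (-(((φ / L : ℝ) : ℂ) * Complex.I))
          else 1)) *
          ((if (e x).1 = 0 ∧ y = e.symm (-1, (e x).2) then Complex.exp (Complex.I * θ₀)
            else if (e y).1 = 0 ∧ x = e.symm (-1, (e y).2) then Complex.exp (-(Complex.I * θ₀)) else 1) *
            expect (creation (orb x σ) * annihilation (orb y σ)) ψ)).re else 0) +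
        (∑ x : Λ, ∑ y : Λ, ∑ σ : Fin 2, if (tubeGraph e).Adj x y then
        ((1 - (if (e x).1 = (e y).1 + 1 ∧ (e x).2 = (e y).2 then Complex.exp ((((-φ) / L : ℝ) : ℂ) * Complex.I)
          else if (e y).1 = (e x).1 + 1 ∧ (e x).2 = (e y).2 then Complex.exp (-((((-φ) / L : ℝ) : ℂ) * Complex.I))
          else 1)) *
          ((if (e x).1 = 0 ∧ y = e.symm (-1, (e x).2) then Complex.exp (Complex.I * θ₀)
            else if (e y).1 = 0 ∧ x = e.symm (-1, (e y).2) then Complex.exp (-(Complex.I * θ₀)) else 1) *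
            expect (creation (orb x σ) * annihilation (orb y σ)) ψ)).re else 0) ≤
        2 * (φ ^ 2 * M / L) := by
      rw [← Finset.sum_add_distrib]
      calc _ ≤ ∑ x : Λ, ∑ y : Λ, ∑ _σ : Fin 2, (2 - 2 * Real.cos (φ / L)) *
            ((if y = e.symm ((e x).1 + 1, (e x).2) then 1 / 2 else 0) +
              (if y = e.symm ((e x).1 - 1, (e x).2) then 1 / 2 else 0)) := by
            refine Finset.sum_le_sum fun x _ => ?_
            rw [← Finset.sum_add_distrib]
            refine Finset.sum_le_sum fun y _ => ?_
            rw [← Finset.sum_add_distrib]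
            refine Finset.sum_le_sum fun σ _ => ?_
            refine summand_pm_le L M Λ e φ x y _ (fun hxy => ?_)
            refine (Complex.abs_re_le_norm _).trans ?_
            rw [norm_mul]
            have hh := norm_star_dotProduct_creation_mul_annihilation_mulVec_le_half h1
              (p := orb x σ) (q := orb y σ) (fun h => hxy (congrArg (fun o : Orb Λ => (ofLex o).1) h))
            have hb := norm_basePhase_le L M Λ e θ₀ x y
            calc _ ≤ 1 * (1 / 2) := mul_le_mul hb hh (norm_nonneg _) zero_le_one
              _ = 1 / 2 := by ring
        _ = (2 - 2 * Real.cos (φ / L)) * (2 * ((L : ℝ) * M)) := sum_weight_eq L M Λ e φ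
        _ ≤ (φ / L) ^ 2 * (2 * ((L : ℝ) * M)) := by
            have := two_sub_two_mul_cos_le_sq (φ / L)
            have h0 : 0 ≤ 2 * ((L : ℝ) * M) := by positivity
            nlinarith
        _ = 2 * (φ ^ 2 * M / L) := by
            have hL0 : (L : ℝ) ≠ 0 := by exact_mod_cast (NeZero.ne L)
            field_simp
    linarith
  by_cases hne : ∃ ψ ∈ szSector (Λ := Λ) N 0, star ψ ⬝ᵥ ψ = (1 : ℂ)
  · obtain ⟨ψ₀, hψ₀, h₀⟩ := hne
    have hS : {E : ℝ | ∃ ψ ∈ szSector (Λ := Λ) N 0, star ψ ⬝ᵥ ψ = 1 ∧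
        E = (star ψ ⬝ᵥ ((tubeH0 L M Λ e U + tubeTwist L M Λ e θ₀) *ᵥ ψ)).re}.Nonempty :=
      ⟨_, ψ₀, hψ₀, h₀, rfl⟩
    have h0 : tubeEnergy L M Λ e U θ₀ N = sInf {E : ℝ | ∃ ψ ∈ szSector (Λ := Λ) N 0, star ψ ⬝ᵥ ψ = 1 ∧
        E = (star ψ ⬝ᵥ ((tubeH0 L M Λ e U + tubeTwist L M Λ e θ₀) *ᵥ ψ)).re} := rfl
    refine le_of_forall_pos_lt_add fun ε hε => ?_
    obtain ⟨E, ⟨ψ, hψ, h1, rfl⟩, hE⟩ := exists_lt_of_csInf_lt hS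
      (lt_add_of_pos_right (sInf {E : ℝ | ∃ ψ ∈ szSector (Λ := Λ) N 0, star ψ ⬝ᵥ ψ = 1 ∧
        E = (star ψ ⬝ᵥ ((tubeH0 L M Λ e U + tubeTwist L M Λ e θ₀) *ᵥ ψ)).re}) (half_pos hε))
    have h := hunit ψ hψ h1
    rw [h0]
    rw [Literature.MathematicalPhysics.QuantumLattice.expect] at h
    linarith
  · have hempty : ∀ A : Matrix (Finset (Orb Λ)) (Finset (Orb Λ)) ℂ, A.minEnergyOn (szSector N 0) = 0 :=
      fun A => by
      unfold Matrix.minEnergyOn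
      convert Real.sInf_empty
      ext E
      simp only [Set.mem_setOf_eq, Set.mem_empty_iff_false, iff_false, not_exists, not_and]
      exact fun ψ hψ h1 _ => hne ⟨ψ, hψ, h1⟩
    rw [tubeEnergy_eq, tubeEnergy_eq, tubeEnergy_eq, hempty, hempty, hempty]
    linarith

/-- **`|E(π) - E(0)| ≤ π²M/L`** (`L ≥ 3`; Bloch from `0`, semiconcavity at `π`, `E(2π) = E(0)`): the
period-halving bound `|E(π) - E(0)| ≤ ηM/L` is free for `η ≥ π²`. [cite: Watanabe2019, §2.2.3 and §4.1] -/
theorem abs_tubeEnergy_pi_sub_zero_le (hL : 3 ≤ L) (U : ℝ) (N : ℕ) :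
    |tubeEnergy L M Λ e U Real.pi N - tubeEnergy L M Λ e U 0 N| ≤ Real.pi ^ 2 * M / L := by
  have hup := tubeEnergy_le_tubeEnergy_zero_add L M Λ e hL U Real.pi N
  have hsc := tubeEnergy_semiconcave L M Λ e hL U Real.pi Real.pi N
  rw [show Real.pi + Real.pi = 0 + 2 * Real.pi by ring, tubeEnergy_add_two_pi, sub_self] at hsc
  rw [abs_sub_le_iff]
  constructor <;> linarith

/-- **`E(2π/3) ≥ E(0) - (8π²/9) M/L`** (`L ≥ 3`; semiconcavity at `2π/3`, `E(4π/3) = E(2π/3)`). [folklore] -/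
theorem tubeEnergy_zero_sub_two_pi_div_three_le (hL : 3 ≤ L) (U : ℝ) (N : ℕ) :
    tubeEnergy L M Λ e U 0 N - tubeEnergy L M Λ e U (2 * Real.pi / 3) N ≤ 8 * Real.pi ^ 2 / 9 * M / L := by
  have hsc := tubeEnergy_semiconcave L M Λ e hL U (2 * Real.pi / 3) (2 * Real.pi / 3) N
  have hper : tubeEnergy L M Λ e U (2 * Real.pi / 3 + 2 * Real.pi / 3) N =
      tubeEnergy L M Λ e U (2 * Real.pi / 3) N := by
    rw [show 2 * Real.pi / 3 + 2 * Real.pi / 3 = -(2 * Real.pi / 3) + 2 * Real.pi by ring,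
      tubeEnergy_add_two_pi, tubeEnergy_neg]
  rw [hper, sub_self] at hsc
  have h9 : 2 * ((2 * Real.pi / 3) ^ 2 * (M : ℝ) / L) = (8 / 9) * (Real.pi ^ 2 * M / L) := by ring
  have h9' : 8 * Real.pi ^ 2 / 9 * (M : ℝ) / L = (8 / 9) * (Real.pi ^ 2 * M / L) := by ring
  rw [h9] at hsc
  rw [h9']
  linarith

/-- **Kinematic floor**: `E(π/3) - E(0) ≥ -(5π²/9) M/L` (`L ≥ 3`); with Bloch, `|E(π/3) - E(0)| ≤ (5π²/9) M/L`. [folklore] -/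
theorem neg_le_tubeEnergy_pi_div_three_sub_zero (hL : 3 ≤ L) (U : ℝ) (N : ℕ) :
    -(5 * Real.pi ^ 2 / 9 * M / L) ≤ tubeEnergy L M Λ e U (Real.pi / 3) N - tubeEnergy L M Λ e U 0 N := by
  have hsc := tubeEnergy_semiconcave L M Λ e hL U (Real.pi / 3) (Real.pi / 3) N
  rw [show Real.pi / 3 + Real.pi / 3 = 2 * Real.pi / 3 by ring, sub_self] at hsc
  have h23 := tubeEnergy_zero_sub_two_pi_div_three_le L M Λ e hL U N
  have hX1 : 2 * ((Real.pi / 3) ^ 2 * (M : ℝ) / L) = (2 / 9) * (Real.pi ^ 2 * M / L) := by ring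
  have hX2 : 8 * Real.pi ^ 2 / 9 * (M : ℝ) / L = (8 / 9) * (Real.pi ^ 2 * M / L) := by ring
  have hX3 : 5 * Real.pi ^ 2 / 9 * (M : ℝ) / L = (5 / 9) * (Real.pi ^ 2 * M / L) := by ring
  rw [hX1] at hsc
  rw [hX2] at h23
  rw [hX3]
  linarith

/-- **A-priori window**: `-10 ≤ ρ̃_{L,M}(U, δ)` for every `U`, `δ`, `L ≥ 3`, `M ≥ 1` and labelling
(with `tubeStiffness_le_two`, `ρ̃ ∈ [-10, 2]`). [folklore] -/
theorem neg_ten_le_tubeStiffness (hL : 3 ≤ L) (U δ : ℝ) : -10 ≤ tubeStiffness L M Λ e U δ := by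
  rw [tubeStiffness_eq]
  have hL0 : (0 : ℝ) < L := by exact_mod_cast Nat.pos_of_ne_zero (NeZero.ne L)
  have hM0 : (0 : ℝ) < M := by exact_mod_cast Nat.pos_of_ne_zero (NeZero.ne M)
  have h := neg_le_tubeEnergy_pi_div_three_sub_zero L M Λ e hL U (tubeFilling L M δ)
  rw [le_div_iff₀ (by positivity)]
  have h2 := mul_le_mul_of_nonneg_left h (by positivity : (0 : ℝ) ≤ 2 * L)
  have e1 : 2 * (L : ℝ) * -(5 * Real.pi ^ 2 / 9 * (M : ℝ) / L) = -10 * ((Real.pi / 3) ^ 2 * (M : ℝ)) := by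
    field_simp
    ring
  rw [e1] at h2
  exact h2

/-- **The flux envelope is symmetric about `π`**: `E(π + φ) = E(π - φ)`. [cite: ByersYang1961, p. 46] -/
theorem tubeEnergy_pi_add_eq_pi_sub (U φ : ℝ) (N : ℕ) :
    tubeEnergy L M Λ e U (Real.pi + φ) N = tubeEnergy L M Λ e U (Real.pi - φ) N := by
  rw [← tubeEnergy_neg L M Λ e U (Real.pi + φ) N, show -(Real.pi + φ) = Real.pi - φ + -(2 * Real.pi) by ring,
    ← tubeEnergy_add_two_pi L M Λ e U (Real.pi - φ + -(2 * Real.pi)) N, neg_add_cancel_right]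

/-- **Bloch's bound from the `π`-flux** (`L ≥ 3`): `E(π + φ) ≤ E(π) + φ²M/L` (semiconcavity at `π`
and the symmetry about `π`). [cite: Watanabe2019, §2.2.3 and §4.1] -/
theorem tubeEnergy_pi_add_le (hL : 3 ≤ L) (U φ : ℝ) (N : ℕ) :
    tubeEnergy L M Λ e U (Real.pi + φ) N ≤ tubeEnergy L M Λ e U Real.pi N + φ ^ 2 * M / L := by
  have hsc := tubeEnergy_semiconcave L M Λ e hL U Real.pi φ N
  rw [← tubeEnergy_pi_add_eq_pi_sub] at hsc
  linarith

end Semiconcave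

end Summit.HubbardSuperconductivity.HubbardSuperconductivity.Theorems.WidthHaldane

end
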